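import Literature.AlgebraicGeometry.HodgeTheory.DivisorClassesFiniteEtaleBaseChange
import Literature.AlgebraicGeometry.HodgeTheory.MotivatedClassesDeformation
import Literature.AlgebraicGeometry.HodgeTheory.MotivatedClassesDeformationInputs
import Literature.AlgebraicGeometry.HodgeTheory.MotivatedClassesTransport
import Literature.AlgebraicGeometry.HodgeTheory.GlobalInvariantCyclesSectionsProofs
import Literature.AlgebraicGeometry.HodgeTheory.ContinuationAlongLiftedPaths
import Literature.AlgebraicGeometry.HodgeTheory.SmoothProjectiveCompactificationProofs
import Literature.AlgebraicGeometry.HodgeTheory.HodgeGenericQbarDescentProofs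
import Literature.AlgebraicGeometry.Motives.ComplexPointsFiniteEtaleCovering
import Literature.AlgebraicGeometry.HodgeTheory.FiniteEtaleCoverOfFiniteIndexSmoothCurve
import Literature.AlgebraicGeometry.Andre1996.HodgeClassesMotivatedAssembly
import HarnessLib

/-!
# André 1996, Corollaire 5.1: parallel transports of a motivated class invariant under a finite-index subgroup of `π₁` are motivated

Family `hodge`, layer `Literature/AlgebraicGeometry/Andre1996` (lane `lit-hodgefound`, Layer B,
DAG-B node **B3-15**, §9 T3). PROOF FILE: theorems only — no definition, no new named fact
(D-0026; net debt 0). The three named facts the statement is conditional on all EXIST in the tree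
and are exactly the three published theorems André's one-line proof invokes (see below).

Source, verbatim (Y. André, *Pour une théorie inconditionnelle des motifs*, Publ. Math. IHÉS 83
(1996) 5–49, §5, print p. 26 = held `paper:doi-10-1007-bf02698643` PDF p0023, lines 5–14; accents
restored, `⟦…⟧` = displayed formula reconstructed from the garbled OCR):

> **COROLLAIRE 5.1.** — Soit `f : X → S` un morphisme projectif et lisse, `S` étant une variété
> algébrique complexe lisse connexe, et soit `s` un point de `S(ℂ)`. Soit
> `T ∈ ⟦H*(X_s)^{⊗m} ⊗ H*(X_s)^{∨ ⊗n}⟧ ⟦un cycle motivé⟧` invariant sous un sous-groupe d'indice fini de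
> `π₁(S(ℂ), s)`. Alors les translatés de `T` par transport parallèle en un point quelconque de `S(ℂ)`
> sont motivés. En particulier, pour tout `γ ∈ π₁(S(ℂ), s)`, `γT` est motivé.
>
> En effet, le sous-groupe d'indice fini définit un revêtement étale `S' → S` et il suffit d'appliquer
> le théorème de déformation à `X' := X ×_S … ×_S X ×_S S' → S'` (en supposant que `𝒱` contienne toutes
> les fibres de `f` de même qu'une compactification lisse de `X'`). □

## Lean rendering (real carriers only; what a reviewer must accept)

* **Carrier.** "un cycle motivé" on the fibre `X_s` = the lane's validated motivated-class carrier
  `HodgeTheory.motivatedClasses n X p ⊆ H²ᵖ(X(ℂ); ℂ)` (André Déf. 1 on the real carriers, file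
  `HodgeTheory/MotivatedClasses`; TRIBUNAL-B v1 B6, unconditional since `nonempty_hardLefschetzNFold_holds`),
  on the fibre `Motives.fiberOver f s`. **Special case typed:** `T` a class of ONE even degree `2p`
  on ONE fibre (`m = 1`, `n = 0` in André's `H*(X_s)^{⊗m} ⊗ H*(X_s)^{∨⊗n}`).
  -- TODO(general form): mixed tensors `T ∈ H*(X_s)^{⊗m} ⊗ H*(X_s)^{∨⊗n}`, which the printed proof
  -- reduces to the present case on the fibre power `X ×_S … ×_S X` by Künneth and Poincaré duality;
  -- the tree has no Künneth decomposition of `H*((X ×_S … ×_S X)_s)` on the real carriers.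
* **Coefficients.** André's `T` is a rational class and `A_mot(X_s)` a `ℚ`-space; the tree's carrier
  is the `ℂ`-span `A_mot(X_s)_ℂ = A_mot(X_s)_ℚ ⊗ ℂ` (Prop. 3.2.1/3.3), exactly as in the tree's
  `Andre1996_deformation`. The `ℂ`-statement follows from the printed `ℚ`-statement (write
  `T = Σ cᵢ Tᵢ` with `Tᵢ` rational motivated and `cᵢ ∈ ℂ` linearly independent over `ℚ`; monodromy
  acts `ℚ`-rationally, so `γT = T` forces `γTᵢ = Tᵢ` for each `i`) — weaker-or-equal, never stronger.
* **"transport parallèle", "γT".** The tree's parallel transport in the local system `R²ᵖ f_* ℂ` on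
  `S(ℂ)`: `HodgeTheory.transportFun f (2p) hU γ` for `γ` a homotopy class of paths in `S(ℂ)`
  (monodromy of the espace étalé `FiberClass f (2p) → S(ℂ)`, file `HodgeTheory/DirectImageTransport`;
  `hU : IsCohomologicallyLocallyTrivialOn f univ` records that `R²ᵖ f_* ℂ` IS a local system —
  Ehresmann, PROVED for smooth projective families over smooth quasi-projective bases,
  `isCohomologicallyLocallyTrivialOn_univ_of_isSmoothProjectiveFamily`; it is a `Prop`, so the
  transport does not depend on the witness). "invariant sous un sous-groupe d'indice fini
  `H ≤ π₁(S(ℂ), s)`" = `∀ γ ∈ H, transportFun f (2p) hU γ T = T` (Mathlib's `FundamentalGroup` of the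
  subspace `univ ⊆ S(ℂ)`, the tree's standing spelling, cf. `exists_finiteEtale_of_finiteIndex_of_riemannExistence`).
  A second form, `…_of_isContinuationAlong`, states hypothesis and conclusion with the witness-free
  flat continuations `IsContinuationAlong γ T β` of `HodgeTheory/HodgeLocus` (equivalent:
  `isContinuationAlong_iff_transportFun_eq`).
* **"f projectif et lisse, S variété algébrique complexe lisse connexe".** `f` a smooth projective
  family of relative dimension `n` (`Motives.IsSmoothProjectiveFamily f n`) which is projective in
  Hartshorne's sense (`f` factors through a closed immersion into `ℙᴺ × S` — the hypothesis shape of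
  the tree's `Andre1996_deformation`), `S` smooth, irreducible (= connected, for `S` smooth) and
  QUASI-PROJECTIVE over `ℂ`. -- TODO(general form): André's "variété" need not be quasi-projective;
  -- quasi-projectivity is what the tree's Riemann-existence fact and global invariant cycle theorem
  -- are stated for.
* **"pour un choix convenable de pièces de base" / "en supposant que 𝒱 contienne …".** The tree's
  `motivatedClasses` takes `𝒱` = all smooth projective complex varieties (the maximal choice), which
  contains the fibres and the compactification in question; nothing to assume.

## The proof (André's, step for step) and the three facts it is conditional on

1. "le sous-groupe d'indice fini définit un revêtement étale `S' → S`": the covering of `S(ℂ)`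
   attached to (the normal core of) `H` is algebraic — **Riemann's existence theorem**, the tree's
   named fact `FundamentalGroup.riemannExistence_finiteCovering` [SGA1, XII Thm. 5.1], through the
   tree's theorem `exists_finiteEtale_of_finiteIndex_of_riemannExistence` (finite étale `g : S' ⟶ S`,
   `S'(ℂ)` path connected, `s' ↦ s`, loops at `s'` map into `H`).
2. Base change `π' : X' = X ×_S S' ⟶ S'` (`Motives.familyPullback`), again a smooth projective family,
   projective in Hartshorne's sense (`Motives.exists_isClosedImmersion_familyPullback`); the transfer
   `T' = e^* T` of `T` to `X'_{s'} ≅ X_s` is invariant under the whole of `π₁(S'(ℂ), s')`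
   (`forall_transportFun_familyPullback_eq`: transport commutes with base change).
3. "il suffit d'appliquer le théorème de déformation à `X' → S'`": André's Thm. 0.5 is printed for a
   SECTION `ξ` of `R²ᵖ f_* ℚ`; the tree's record `HodgeTheory.Andre1996_deformation` is its
   global-class form, and the passage section ↦ global class is **Deligne's théorème de la partie
   fixe** (the engine of André's own proof of 0.5, §5.1: "Nous nous appuierons sur le « théorème de
   la partie fixe » de Deligne [D71] 4.1.1"), the tree's named fact `deligne_globalInvariantCycles`
   [DeligneHodgeII1971, Thm. 4.1.1], applied on a smooth compactification of `X'` ("une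
   compactification lisse de `X'`"; Hironaka, PROVED in the tree: `exists_isSmoothProjective_isOpenImmersion`)
   through the tree's theorem `deligne_globalInvariantCycles.of_forall_transportFun_eq`. Then
   **Thm. 0.5** (`Andre1996_deformation`) moves motivatedness from `X'_{s'}` to every fibre of `π'`.
4. "les translatés de `T` par transport parallèle en un point quelconque de `S(ℂ)`": a path `γ` from
   `s` to `t` lifts to `S'(ℂ)` (`g(ℂ)` is a covering map, `Motives.ComplexPoints.isCoveringMap_map_of_isFinite`;
   `exists_path_lift_of_isCoveringMapOn`), transport along `γ` is transport along the lift read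
   through the fibre isomorphisms (`FiberClass.baseChange_transportFun`), which is the restriction of
   the global class (`transportFun_map_fiberι`), motivated by step 3; motivated classes transport
   along isomorphisms of fibres (`map_mem_motivatedClasses_of_iso`).

So the theorem is conditional on exactly `riemannExistence_finiteCovering`, `deligne_globalInvariantCycles`
and `Andre1996_deformation` (hypotheses `hRE`, `hGIC`, `h05`), all pre-existing named facts of the
tree with their own cites; this file introduces none. Architecture as in the tree's
`exists_finiteEtale_algebraicClasses_span_of_finite_monodromy` (`HodgeTheory/DivisorClassesFiniteEtaleBaseChange`,
Voisin 2007 §3, proof of Prop. 0.7 — the same monodromy argument for divisor classes).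

## Contents

* `transportFun_mem_motivatedClasses_of_finiteEtaleCover` — steps 2–4 with the finite étale cover
  `g : S' ⟶ S` of step 1 GIVEN (hypotheses `hGIC`, `h05` only);
* `transportFun_mem_motivatedClasses_of_finiteIndex` — Cor. 5.1 over a smooth irreducible
  quasi-projective base (step 1 by the named fact `riemannExistence_finiteCovering`), with the
  «en particulier» form `transportFun_toPath_mem_motivatedClasses_of_finiteIndex` and the
  witness-free flat-continuation form `mem_motivatedClasses_of_isContinuationAlong_of_finiteIndex`;
* `transportFun_mem_motivatedClasses_of_finiteIndex_smoothCurve` — Cor. 5.1 over a smooth CURVE,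
  where step 1 is the tree's THEOREM `exists_finiteEtale_of_finiteIndex_smoothCurve` (Riemann's
  existence theorem for smooth curves, `FundamentalGroup.riemannExistence_smoothCurve`): hypotheses
  `hGIC`, `h05` only; and its instance on the tree's compact pencils of abelian varieties
  (`Motives.IsCompactAbelianPencil`, the families of André's Thm. 0.6.2 / §6.3),
  `transportFun_mem_motivatedClasses_of_finiteIndex_compactPencil`, with the local-system witness
  `isCohomologicallyLocallyTrivialOn_univ_of_isCompactAbelianPencil`.

Deligne's absolute-Hodge twin of this corollary is LNM 900, I, Thm. 2.15 (DAG-B B1-15, §9 T2).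

## References

* [Andre1996Motifs] Y. André, *Pour une théorie inconditionnelle des motifs*, Publ. Math. IHÉS 83
  (1996) 5–49: Cor. 5.1 and its proof (p. 26), Thm. 0.5 (p. 8), §5.1 (p. 25).
* [SGA1] A. Grothendieck, M. Raynaud, SGA 1, Exp. XII Thm. 5.1 (Riemann's existence theorem).
* [DeligneHodgeII1971] P. Deligne, *Théorie de Hodge II*, Publ. Math. IHÉS 40 (1971), Thm. 4.1.1.
* [CharlesSchnell2014Notes] F. Charles, C. Schnell, *Notes on absolute Hodge classes* (2014),
  Thm. 11.3.4 (global invariant cycle theorem, the form vendored as `deligne_globalInvariantCycles`).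
* [Voisin2007HodgeLoci] C. Voisin, *Hodge loci and absolute Hodge classes*, Compositio Math. 143
  (2007), §3, proof of Prop. 0.7 (the monodromy argument: étale cover trivialising the monodromy,
  then the global invariant cycle theorem).
* [VoisinHodgeII2003] C. Voisin, *Hodge Theory and Complex Algebraic Geometry II*, CUP 2003, §3.1.2,
  Lemma 4.17 (invariants = global sections).
* [HatcherAT2002] A. Hatcher, *Algebraic Topology*, CUP 2002, §1.3 Prop. 1.30 (path lifting),
  Prop. 1.36.
-/

noncomputable section

open CategoryTheory AlgebraicGeometry MonoidalCategory
open _root_.Topology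
open Literature.AlgebraicTopology.SingularHomology

namespace Literature.AlgebraicGeometry.Andre1996

open Literature.AlgebraicGeometry.Motives Literature.AlgebraicGeometry.HodgeTheory

/-! ### The core of Cor. 5.1: the argument granted the finite étale cover `S' → S` of step 1 -/

/-- **André 1996, Cor. 5.1 — the proof from step 2 on, with the finite étale cover of step 1 GIVEN
AS DATA** (so that the corollary can be instantiated both with Riemann's existence theorem for
quasi-projective bases, a named fact, and with its PROVED form over smooth curves). Granted the
global invariant cycle theorem (`deligne_globalInvariantCycles`) and Thm. 0.5
(`Andre1996_deformation`): let `f : 𝒳 ⟶ S` be a smooth projective family of relative dimension `n`,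
projective in Hartshorne's sense, over a smooth irreducible quasi-projective complex `S`;
`g : S' ⟶ S` FINITE ÉTALE with `S'(ℂ)` path connected, `s' ∈ S'(ℂ)`; `T ∈ A_motᵖ(X_{g s'})_ℂ` a
motivated class such that the image under `g(ℂ)` of EVERY loop of `S'(ℂ)` at `s'` fixes `T` by
monodromy («le sous-groupe d'indice fini définit un revêtement étale `S' → S`» — here the cover is
the hypothesis). Then every parallel transport of `T` to any `t ∈ S(ℂ)` is motivated. Proof: module
docstring, steps 2–4 (base change to `S'`, partie fixe on a smooth compactification of `X ×_S S'`,
Thm. 0.5, path lifting along the covering `g(ℂ)`).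
[cite: Andre1996Motifs, Cor. 5.1 and its proof (p. 26); Thm. 0.5 (p. 8)]
[cite: DeligneHodgeII1971, Théorème 4.1.1] [cite: Voisin2007HodgeLoci, §3, proof of Prop. 0.7] -/
theorem transportFun_mem_motivatedClasses_of_finiteEtaleCover
    (hGIC : deligne_globalInvariantCycles) (h05 : Andre1996_deformation)
    {n : ℕ} {𝒳 S : SchemeOver ℂ} (f : 𝒳 ⟶ S) (hf : IsSmoothProjectiveFamily f n)
    (hι : ∃ (N : ℕ) (ι : 𝒳 ⟶ projectiveSpace N ℂ ⊗ S),
      IsClosedImmersion ι.left ∧ ι ≫ CartesianMonoidalCategory.snd (projectiveSpace N ℂ) S = f)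
    (hS : IsQuasiProjectiveOver S) [Smooth S.hom] [IrreducibleSpace S.left]
    (hU : IsCohomologicallyLocallyTrivialOn f (Set.univ : Set (ComplexPoints S)))
    {S' : SchemeOver ℂ} (g : S' ⟶ S) [IsFinite g.left] [Etale g.left]
    [PathConnectedSpace (ComplexPoints S')] (s' : ComplexPoints S')
    {p : ℕ} {T : complexBetti (fiberOver f (AlgPoints.map g s')) (2 * p)}
    (hT : T ∈ motivatedClasses n (fiberOver f (AlgPoints.map g s')) p)
    (hinv : ∀ γ' : Path (⟨s', Set.mem_univ s'⟩ : (Set.univ : Set (ComplexPoints S')))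
        ⟨s', Set.mem_univ s'⟩,
      transportFun f (2 * p) hU
        (s := ⟨AlgPoints.map g s', Set.mem_univ _⟩) (t := ⟨AlgPoints.map g s', Set.mem_univ _⟩)
        ⟦γ'.map ((((AlgPoints.continuous_map g).comp continuous_subtype_val)).subtype_mk
          fun _ ↦ Set.mem_univ _)⟧ T = T)
    (t : ComplexPoints S)
    (γ : Path.Homotopic.Quotient
      (⟨AlgPoints.map g s', Set.mem_univ _⟩ : (Set.univ : Set (ComplexPoints S))) ⟨t, Set.mem_univ t⟩) :
    transportFun f (2 * p) hU γ T ∈ motivatedClasses n (fiberOver f t) p := by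
  -- Step 0: the base `S` is smooth of a pure dimension `d`, separated, locally of finite type
  obtain ⟨d, hd⟩ := Motives.exists_smoothOfRelativeDimension_of_smooth S.hom
  haveI := hd
  haveI : LocallyOfFiniteType S.hom := hS.locallyOfFiniteType
  haveI : IsSeparated S.hom := hS.isVarietyPair_ofScheme.isSeparated
  -- (Step 1 is the hypothesis `g`.) `S'` is smooth of pure dimension `d`, irreducible,
  -- quasi-projective; `g` is surjective; `g(ℂ)` is a local homeomorphism and a covering map;
  -- `S'(ℂ)` is a connected manifold
  haveI hg0 : SmoothOfRelativeDimension 0 g.left := inferInstance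
  haveI : AlgebraicGeometry.Smooth g.left := SmoothOfRelativeDimension.smooth 0 _
  haveI hS'd : SmoothOfRelativeDimension d S'.hom := by
    have h : SmoothOfRelativeDimension (0 + d) (g.left ≫ S.hom) := inferInstance
    rw [Over.w] at h
    simpa using h
  haveI : AlgebraicGeometry.Smooth S'.hom := SmoothOfRelativeDimension.smooth d _
  haveI : ConnectedSpace (ComplexPoints S') := inferInstance
  haveI hS'irr : IrreducibleSpace S'.left := irreducibleSpace_left_of_connectedSpace_complexPoints
  haveI : Nonempty S'.left := inferInstance
  haveI hgsurj : Surjective g.left := surjective_of_isFinite_of_etale_of_irreducible g.left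
  haveI : IsReduced S.left := Motives.isReduced_of_smooth_over_field S.hom
  haveI : IsReduced S'.left := Motives.isReduced_of_smooth_over_field S'.hom
  haveI : IsIntegral S.left := isIntegral_of_irreducibleSpace_of_isReduced S.left
  haveI : IsIntegral S'.left := isIntegral_of_irreducibleSpace_of_isReduced S'.left
  have hS'qp : IsQuasiProjectiveOver S' := isQuasiProjectiveOver_of_isFinite_of_surjective g hS
  haveI : LocallyOfFiniteType S'.hom := hS'qp.locallyOfFiniteType
  haveI : IsSeparated S'.hom := hS'qp.isVarietyPair_ofScheme.isSeparated
  haveI : QuasiCompact S'.hom := hS'qp.isVarietyPair_ofScheme.quasiCompact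
  letI := Motives.ComplexPoints.chartedSpace S' d
  haveI : LocallyPathConnectedSpace (ComplexPoints S') :=
    ChartedSpace.locallyPathConnectedSpace (EuclideanSpace ℝ (Fin (2 * d))) _
  have hgloc : IsLocalHomeomorph (AlgPoints.map g : ComplexPoints S' → ComplexPoints S) :=
    Motives.ComplexPoints.isLocalHomeomorph_map d _
  have hgcov : IsCoveringMap (AlgPoints.map g : ComplexPoints S' → ComplexPoints S) :=
    (Motives.ComplexPoints.isCoveringMap_map_of_isFinite d g).1
  -- Step 2 (base change «`X' := X ×_S S' → S'`»): the family `π'`, its local system, the fibre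
  -- isomorphism `e : X'_{s'} ≅ X_{s}`, the transfer `e^* T`, invariant under ALL loops at `s'`
  set π' := familyPullback.snd f g
  have hf' : IsSmoothProjectiveFamily π' n := hf.familyPullback_snd g
  have hU' := isCohomologicallyLocallyTrivialOn_univ_of_isSmoothProjectiveFamily π' d hf' hS'qp
  -- the transfer `α' = e^* T` of `T` to the fibre `X'_{s'}` (`e : X'_{s'} ≅ X_{g s'}`), and `(g s', T)`
  -- as the transfer of the fibre class `(s', α')`
  have hα : (FiberClass.baseChange f g (2 * p)
      ⟨s', complexBetti.map (fiberOverFamilyPullbackIso f g s').hom (2 * p) T⟩).cls = T :=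
    FiberClass.cls_baseChange_map_hom _ _ _ s' T
  have h₀' : (⟨(⟨AlgPoints.map g s', Set.mem_univ _⟩ : (Set.univ : Set (ComplexPoints S))).1, T⟩ :
        FiberClass f (2 * p)) =
      FiberClass.baseChange f g (2 * p)
        ⟨s', complexBetti.map (fiberOverFamilyPullbackIso f g s').hom (2 * p) T⟩ := by
    conv_lhs => rw [← hα]
    rfl
  have hinv' := forall_transportFun_familyPullback_eq f g (2 * p) hgloc hU hU' s'
    (complexBetti.map (fiberOverFamilyPullbackIso f g s').hom (2 * p) T) hα hinv
  -- Step 3 («une compactification lisse de `X'`» + partie fixe): `e^* T` is the restriction of a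
  -- global class `A₁` of `X'`
  haveI := hf'.smoothOfRelativeDimension
  haveI : SmoothOfRelativeDimension (n + d) (familyPullback f g).hom := by
    rw [← Over.w π']
    infer_instance
  haveI : IrreducibleSpace (familyPullback f g).left := irreducibleSpace_of_isSmoothProjectiveFamily π' hf'
  obtain ⟨N, ι', hι', hι'π⟩ := Motives.exists_isClosedImmersion_familyPullback f g hι
  haveI := hι'
  have hV'qp : IsQuasiProjectiveOver (familyPullback f g) :=
    IsQuasiProjectiveOver.of_isClosedImmersion_projectiveSpace_tensor ι' hS'qp
  obtain ⟨Xbar, i, hXbar, hi⟩ :=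
    exists_isSmoothProjective_isOpenImmersion (n + d) (familyPullback f g) inferInstance hV'qp inferInstance
  haveI := hi
  obtain ⟨A, hA⟩ := hGIC.of_forall_transportFun_eq π' i hf' hS'qp (SmoothOfRelativeDimension.smooth d _)
    hXbar.isProjectiveOver hXbar.smoothOfRelativeDimension hi hU' (2 * p) s'
    (complexBetti.map (fiberOverFamilyPullbackIso f g s').hom (2 * p) T) hinv'
  set A₁ : complexBetti (familyPullback f g) (2 * p) := complexBetti.map i (2 * p) A
  have hA' : complexBetti.map (fiberOverFamilyPullbackIso f g s').hom (2 * p) T =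
      complexBetti.map (fiberι π' s') (2 * p) A₁ := by
    rw [hA, complexBetti.map_comp, ModuleCat.comp_apply]
  -- Step 4 («il suffit d'appliquer le théorème de déformation à `X' → S'`»): Thm. 0.5 on `π'`
  have h₀ : complexBetti.map (fiberι π' s') (2 * p) A₁ ∈ motivatedClasses n (fiberOver π' s') p := by
    rw [← hA']
    exact map_mem_motivatedClasses_of_iso (hf.isSmoothProjective _) (hf'.isSmoothProjective s')
      (fiberOverFamilyPullbackIso f g s') hT
  have hmot : ∀ t' : ComplexPoints S',
      complexBetti.map (fiberι π' t') (2 * p) A₁ ∈ motivatedClasses n (fiberOver π' t') p :=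
    h05 π' hf' ⟨N, ι', hι', hι'π⟩ inferInstance inferInstance inferInstance inferInstance p A₁ s' h₀
  -- Step 5 («transport parallèle en un point quelconque de `S(ℂ)`»): lift `γ` to `S'(ℂ)` from
  -- `s'`; transport along `γ` is the transfer of transport along the lift, i.e. of `A₁|_{X'_{t'}}`
  induction γ using Quotient.ind with | _ γ =>
  obtain ⟨t', γ', hγ'⟩ := exists_path_lift_of_isCoveringMapOn
    ((isCoveringMap_iff_isCoveringMapOn_univ).1 hgcov) (γ.map continuous_subtype_val)
    (fun _ ↦ Set.mem_univ _) s' rfl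
  let ιS' : ComplexPoints S' → (Set.univ : Set (ComplexPoints S')) := fun x ↦ ⟨x, Set.mem_univ x⟩
  have hιS' : Continuous ιS' := continuous_id.subtype_mk _
  have hcomp := FiberClass.baseChange_transportFun f g (2 * p) hgloc hU hU' γ
    (s' := ιS' s') (t' := ιS' t') (γ'.map hιS') (fun u ↦ hγ' u)
    (complexBetti.map (fiberOverFamilyPullbackIso f g s').hom (2 * p) T) h₀'
  have hup : transportFun π' (2 * p) hU' (s := ιS' s') (t := ιS' t') ⟦γ'.map hιS'⟧
        (complexBetti.map (fiberOverFamilyPullbackIso f g s').hom (2 * p) T) =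
      complexBetti.map (fiberι π' t') (2 * p) A₁ := by
    rw [hA']
    exact transportFun_map_fiberι π' (2 * p) hU' _ A₁
  rw [hup] at hcomp
  -- `hcomp : (t, γ_* T) = transfer of (t', A₁|_{X'_{t'}}) = (g t', (e_{t'}⁻¹)^* (A₁|_{X'_{t'}}))`, and
  -- `(e_{t'}⁻¹)^* (A₁|_{X'_{t'}})` is motivated on `X_{g t'}` (transport along `X_{g t'} ≅ X'_{t'}`)
  have hfin := map_mem_motivatedClasses_of_iso (hf'.isSmoothProjective t') (hf.isSmoothProjective _)
    (fiberOverFamilyPullbackIso f g t').symm (hmot t')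
  exact (FiberClass.prop_iff_of_mk_eq (fun u x ↦ x ∈ motivatedClasses n (fiberOver f u) p) hcomp).2 hfin

/-! ### Cor. 5.1, transport form -/

/-- **André 1996, Cor. 5.1 (parallel transports of a finite-index-invariant motivated class are
motivated)**, single-degree Betti form on the real carriers, GRANTED Riemann's existence theorem
(`FundamentalGroup.riemannExistence_finiteCovering`), the global invariant cycle theorem
(`deligne_globalInvariantCycles`) and André's deformation theorem 0.5 (`Andre1996_deformation`).
Let `f : 𝒳 ⟶ S` be a smooth projective family of relative dimension `n`, projective in Hartshorne's
sense, over a smooth irreducible quasi-projective complex `S`; `s ∈ S(ℂ)`;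
`T ∈ A_motᵖ(X_s)_ℂ = motivatedClasses n (fiberOver f s) p` a motivated class invariant under the
monodromy of a finite-index subgroup `H ≤ π₁(S(ℂ), s)`. Then for every `t ∈ S(ℂ)` and every homotopy
class of paths `γ` from `s` to `t`, the parallel transport `γ_* T ∈ H²ᵖ(X_t(ℂ); ℂ)` is motivated:
«les translatés de `T` par transport parallèle en un point quelconque de `S(ℂ)` sont motivés».
Proof = the printed one: the finite étale cover `S' → S` of `H`, Thm. 0.5 on `X ×_S S' → S'` (module
docstring, steps 1–4). [cite: Andre1996Motifs, Cor. 5.1 and its proof (p. 26); Thm. 0.5 (p. 8)]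
[cite: SGA1, Exp. XII Thm. 5.1] [cite: DeligneHodgeII1971, Théorème 4.1.1]
[cite: Voisin2007HodgeLoci, §3, proof of Prop. 0.7] -/
theorem transportFun_mem_motivatedClasses_of_finiteIndex
    (hRE : FundamentalGroup.riemannExistence_finiteCovering) (hGIC : deligne_globalInvariantCycles)
    (h05 : Andre1996_deformation)
    {n : ℕ} {𝒳 S : SchemeOver ℂ} (f : 𝒳 ⟶ S) (hf : IsSmoothProjectiveFamily f n)
    (hι : ∃ (N : ℕ) (ι : 𝒳 ⟶ projectiveSpace N ℂ ⊗ S),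
      IsClosedImmersion ι.left ∧ ι ≫ CartesianMonoidalCategory.snd (projectiveSpace N ℂ) S = f)
    (hS : IsQuasiProjectiveOver S) [Smooth S.hom] [IrreducibleSpace S.left]
    (hU : IsCohomologicallyLocallyTrivialOn f (Set.univ : Set (ComplexPoints S)))
    {s : ComplexPoints S} {p : ℕ} {T : complexBetti (fiberOver f s) (2 * p)}
    (hT : T ∈ motivatedClasses n (fiberOver f s) p)
    (H : Subgroup (FundamentalGroup (Set.univ : Set (ComplexPoints S)) ⟨s, Set.mem_univ s⟩))
    [H.FiniteIndex]
    (hH : ∀ γ ∈ H, transportFun f (2 * p) hU (FundamentalGroup.toPath γ) T = T)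
    (t : ComplexPoints S)
    (γ : Path.Homotopic.Quotient (⟨s, Set.mem_univ s⟩ : (Set.univ : Set (ComplexPoints S)))
      ⟨t, Set.mem_univ t⟩) :
    transportFun f (2 * p) hU γ T ∈ motivatedClasses n (fiberOver f t) p := by
  -- Step 0: the base `S` is smooth of a pure dimension `d`, separated, locally of finite type
  obtain ⟨d, hd⟩ := Motives.exists_smoothOfRelativeDimension_of_smooth S.hom
  haveI := hd
  haveI : LocallyOfFiniteType S.hom := hS.locallyOfFiniteType
  haveI : IsSeparated S.hom := hS.isVarietyPair_ofScheme.isSeparated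
  -- Step 1 («le sous-groupe d'indice fini définit un revêtement étale `S' → S`»): Riemann existence,
  -- the named fact, for the quasi-projective `S`
  obtain ⟨S', g, s', hs, hgfin, hget, hS'pc, hloops⟩ :=
    exists_finiteEtale_of_finiteIndex_of_riemannExistence hRE S hS d s H
  subst hs
  haveI := hgfin
  haveI := hget
  haveI := hS'pc
  -- Steps 2–4
  exact transportFun_mem_motivatedClasses_of_finiteEtaleCover hGIC h05 f hf hι hS hU g s' hT
    (fun γ' ↦ hH _ (hloops γ')) t γ

/-- **André 1996, Cor. 5.1, «En particulier, pour tout `γ ∈ π₁(S(ℂ), s)`, `γT` est motivé»**: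
under the hypotheses of `transportFun_mem_motivatedClasses_of_finiteIndex`, the monodromy image
`γ_* T` of `T` under EVERY element `γ` of the fundamental group (not only of `H`) is motivated.
[cite: Andre1996Motifs, Cor. 5.1 (p. 26)] -/
theorem transportFun_toPath_mem_motivatedClasses_of_finiteIndex
    (hRE : FundamentalGroup.riemannExistence_finiteCovering) (hGIC : deligne_globalInvariantCycles)
    (h05 : Andre1996_deformation)
    {n : ℕ} {𝒳 S : SchemeOver ℂ} (f : 𝒳 ⟶ S) (hf : IsSmoothProjectiveFamily f n)
    (hι : ∃ (N : ℕ) (ι : 𝒳 ⟶ projectiveSpace N ℂ ⊗ S),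
      IsClosedImmersion ι.left ∧ ι ≫ CartesianMonoidalCategory.snd (projectiveSpace N ℂ) S = f)
    (hS : IsQuasiProjectiveOver S) [Smooth S.hom] [IrreducibleSpace S.left]
    (hU : IsCohomologicallyLocallyTrivialOn f (Set.univ : Set (ComplexPoints S)))
    {s : ComplexPoints S} {p : ℕ} {T : complexBetti (fiberOver f s) (2 * p)}
    (hT : T ∈ motivatedClasses n (fiberOver f s) p)
    (H : Subgroup (FundamentalGroup (Set.univ : Set (ComplexPoints S)) ⟨s, Set.mem_univ s⟩))
    [H.FiniteIndex]
    (hH : ∀ γ ∈ H, transportFun f (2 * p) hU (FundamentalGroup.toPath γ) T = T)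
    (γ : FundamentalGroup (Set.univ : Set (ComplexPoints S)) ⟨s, Set.mem_univ s⟩) :
    transportFun f (2 * p) hU (FundamentalGroup.toPath γ) T ∈ motivatedClasses n (fiberOver f s) p :=
  transportFun_mem_motivatedClasses_of_finiteIndex hRE hGIC h05 f hf hι hS hU hT H hH s
    (FundamentalGroup.toPath γ)

/-! ### Cor. 5.1, flat-continuation form (no local-system witness in the statement) -/

/-- **André 1996, Cor. 5.1, stated with flat continuations.** Same hypotheses on `f`, `S`, `s`, `T`
as `transportFun_mem_motivatedClasses_of_finiteIndex`, invariance and conclusion phrased with the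
witness-free `IsContinuationAlong` of `HodgeTheory/HodgeLocus` (a path of fibre classes over `γ`
from `(s, T)` to `(t, β)`; for smooth projective families this IS parallel transport,
`isContinuationAlong_iff_transportFun_eq`): if `T ∈ A_motᵖ(X_s)_ℂ` is its own continuation along
every loop at `s` whose class lies in a finite-index subgroup `H ≤ π₁(S(ℂ), s)`, then every flat
continuation `β` of `T` along any path from `s` to any `t ∈ S(ℂ)` is motivated.
[cite: Andre1996Motifs, Cor. 5.1 and its proof (p. 26)] [cite: SGA1, Exp. XII Thm. 5.1]
[cite: DeligneHodgeII1971, Théorème 4.1.1] -/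
theorem mem_motivatedClasses_of_isContinuationAlong_of_finiteIndex
    (hRE : FundamentalGroup.riemannExistence_finiteCovering) (hGIC : deligne_globalInvariantCycles)
    (h05 : Andre1996_deformation)
    {n : ℕ} {𝒳 S : SchemeOver ℂ} (f : 𝒳 ⟶ S) (hf : IsSmoothProjectiveFamily f n)
    (hι : ∃ (N : ℕ) (ι : 𝒳 ⟶ projectiveSpace N ℂ ⊗ S),
      IsClosedImmersion ι.left ∧ ι ≫ CartesianMonoidalCategory.snd (projectiveSpace N ℂ) S = f)
    (hS : IsQuasiProjectiveOver S) [Smooth S.hom] [IrreducibleSpace S.left]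
    {s : ComplexPoints S} {p : ℕ} {T : complexBetti (fiberOver f s) (2 * p)}
    (hT : T ∈ motivatedClasses n (fiberOver f s) p)
    (H : Subgroup (FundamentalGroup (Set.univ : Set (ComplexPoints S)) ⟨s, Set.mem_univ s⟩))
    [H.FiniteIndex]
    (hH : ∀ γ : Path s s,
      FundamentalGroup.fromPath
          (⟦γ.map (continuous_id.subtype_mk fun x ↦ Set.mem_univ x)⟧ :
            Path.Homotopic.Quotient (⟨s, Set.mem_univ s⟩ : (Set.univ : Set (ComplexPoints S)))
              ⟨s, Set.mem_univ s⟩) ∈ H →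
        IsContinuationAlong γ T T)
    {t : ComplexPoints S} (γ : Path s t) {β : complexBetti (fiberOver f t) (2 * p)}
    (hβ : IsContinuationAlong γ T β) : β ∈ motivatedClasses n (fiberOver f t) p := by
  -- `R²ᵖ f_* ℂ` is a local system on `S(ℂ)` (Ehresmann, proved for such families)
  obtain ⟨d, hd⟩ := Motives.exists_smoothOfRelativeDimension_of_smooth S.hom
  haveI := hd
  have hU := isCohomologicallyLocallyTrivialOn_univ_of_isSmoothProjectiveFamily f d hf hS
  -- invariance under `H` in transport form
  have hH' : ∀ δ ∈ H, transportFun f (2 * p) hU (FundamentalGroup.toPath δ) T = T := by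
    intro δ hδ
    obtain ⟨δ₀, hδ₀⟩ := Quotient.exists_rep (FundamentalGroup.toPath δ)
    -- the loop `δ₀` read in `S(ℂ)` and back in the subtype `univ` is `δ₀` (definitionally)
    have hq : (⟦(δ₀.map continuous_subtype_val).map (continuous_id.subtype_mk fun x ↦ Set.mem_univ x)⟧ :
        Path.Homotopic.Quotient (⟨s, Set.mem_univ s⟩ : (Set.univ : Set (ComplexPoints S)))
          ⟨s, Set.mem_univ s⟩) = FundamentalGroup.toPath δ := hδ₀
    have hmem : FundamentalGroup.fromPath
        (⟦(δ₀.map continuous_subtype_val).map (continuous_id.subtype_mk fun x ↦ Set.mem_univ x)⟧ :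
          Path.Homotopic.Quotient (⟨s, Set.mem_univ s⟩ : (Set.univ : Set (ComplexPoints S)))
            ⟨s, Set.mem_univ s⟩) ∈ H := by
      rw [hq]
      exact hδ
    have hc := (isContinuationAlong_iff_transportFun_eq f (2 * p) hU (s := s) (t := s)
      (δ₀.map continuous_subtype_val) T T).1 (hH _ hmem)
    rw [hq] at hc
    exact hc
  -- the continuation `β` is the transport of `T` along `γ`
  have hβ' := (isContinuationAlong_iff_transportFun_eq f (2 * p) hU (s := s) (t := t) γ T β).1 hβ
  rw [← hβ']
  exact transportFun_mem_motivatedClasses_of_finiteIndex hRE hGIC h05 f hf hι hS hU hT H hH' t _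

/-! ### Cor. 5.1 over a smooth CURVE and on a compact pencil: Riemann existence is then a theorem -/

/-- **André 1996, Cor. 5.1 for a family over a smooth CURVE**, granted only the global invariant
cycle theorem (`deligne_globalInvariantCycles`) and Thm. 0.5 (`Andre1996_deformation`): over a smooth
irreducible quasi-projective complex CURVE `S` (smooth of relative dimension `1`), step 1 of the
printed proof — «le sous-groupe d'indice fini définit un revêtement étale `S' → S`» — is a THEOREM
of the tree (Riemann's existence theorem for smooth curves, `exists_finiteEtale_of_finiteIndex_smoothCurve`,
from `FundamentalGroup.riemannExistence_smoothCurve`), so the named fact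
`riemannExistence_finiteCovering` is not needed. Same statement otherwise as
`transportFun_mem_motivatedClasses_of_finiteIndex`: every parallel transport of a motivated class
`T ∈ A_motᵖ(X_s)_ℂ` fixed by a finite-index subgroup of `π₁(S(ℂ), s)` is motivated. (André, §5.1,
reduces Thm. 0.5 itself to curves: «Il existe une variété affine lisse connexe `S'` (par exemple une
courbe) …».) [cite: Andre1996Motifs, Cor. 5.1 and its proof (p. 26); §5.1 (p. 25)]
[cite: SGA1, Exp. XII Thm. 5.1 (smooth curves: proved in the tree)]
[cite: DeligneHodgeII1971, Théorème 4.1.1] -/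
theorem transportFun_mem_motivatedClasses_of_finiteIndex_smoothCurve
    (hGIC : deligne_globalInvariantCycles) (h05 : Andre1996_deformation)
    {n : ℕ} {𝒳 S : SchemeOver ℂ} (f : 𝒳 ⟶ S) (hf : IsSmoothProjectiveFamily f n)
    (hι : ∃ (N : ℕ) (ι : 𝒳 ⟶ projectiveSpace N ℂ ⊗ S),
      IsClosedImmersion ι.left ∧ ι ≫ CartesianMonoidalCategory.snd (projectiveSpace N ℂ) S = f)
    (hS : IsQuasiProjectiveOver S) [SmoothOfRelativeDimension 1 S.hom] [IrreducibleSpace S.left]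
    (hU : IsCohomologicallyLocallyTrivialOn f (Set.univ : Set (ComplexPoints S)))
    {s : ComplexPoints S} {p : ℕ} {T : complexBetti (fiberOver f s) (2 * p)}
    (hT : T ∈ motivatedClasses n (fiberOver f s) p)
    (H : Subgroup (FundamentalGroup (Set.univ : Set (ComplexPoints S)) ⟨s, Set.mem_univ s⟩))
    [H.FiniteIndex]
    (hH : ∀ γ ∈ H, transportFun f (2 * p) hU (FundamentalGroup.toPath γ) T = T)
    (t : ComplexPoints S)
    (γ : Path.Homotopic.Quotient (⟨s, Set.mem_univ s⟩ : (Set.univ : Set (ComplexPoints S)))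
      ⟨t, Set.mem_univ t⟩) :
    transportFun f (2 * p) hU γ T ∈ motivatedClasses n (fiberOver f t) p := by
  haveI : Smooth S.hom := SmoothOfRelativeDimension.smooth 1 S.hom
  haveI : IsSeparated S.hom := hS.isVarietyPair_ofScheme.isSeparated
  -- Step 1, PROVED over a smooth curve: the finite étale cover attached to `H`
  obtain ⟨S', g, s', hs, hgfin, hget, hS'pc, hloops⟩ :=
    exists_finiteEtale_of_finiteIndex_smoothCurve S s H
  subst hs
  haveI := hgfin
  haveI := hget
  haveI := hS'pc
  -- Steps 2–4
  exact transportFun_mem_motivatedClasses_of_finiteEtaleCover hGIC h05 f hf hι hS hU g s' hT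
    (fun γ' ↦ hH _ (hloops γ')) t γ

/-- **André 1996, Cor. 5.1 on a compact pencil of abelian varieties** (the families of Thm. 0.6.2 /
§6.3, the tree's `Motives.IsCompactAbelianPencil f d`: smooth projective total space and base
CURVE, `f` a smooth projective family of relative dimension `d` with abelian fibres), granted only
`deligne_globalInvariantCycles` and `Andre1996_deformation`: every parallel transport of a motivated
class `T ∈ A_motᵖ(X_s)_ℂ` fixed by a finite-index subgroup of `π₁(S(ℂ), s)` is motivated. The base is
a smooth projective curve, so Riemann's existence theorem is the tree's theorem
(`transportFun_mem_motivatedClasses_of_finiteIndex_smoothCurve`); projectivity of `f` in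
Hartshorne's sense is `compactPencil_exists_closedImmersion`.
[cite: Andre1996Motifs, Cor. 5.1 (p. 26) and §6.3 footnote (2) (p. 31)]
[cite: DeligneHodgeII1971, Théorème 4.1.1] -/
theorem transportFun_mem_motivatedClasses_of_finiteIndex_compactPencil
    (hGIC : deligne_globalInvariantCycles) (h05 : Andre1996_deformation)
    {d : ℕ} {𝒳 S : SchemeOver ℂ} {f : 𝒳 ⟶ S} (hf : IsCompactAbelianPencil f d)
    (hU : IsCohomologicallyLocallyTrivialOn f (Set.univ : Set (ComplexPoints S)))
    {s : ComplexPoints S} {p : ℕ} {T : complexBetti (fiberOver f s) (2 * p)}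
    (hT : T ∈ motivatedClasses d (fiberOver f s) p)
    (H : Subgroup (FundamentalGroup (Set.univ : Set (ComplexPoints S)) ⟨s, Set.mem_univ s⟩))
    [H.FiniteIndex]
    (hH : ∀ γ ∈ H, transportFun f (2 * p) hU (FundamentalGroup.toPath γ) T = T)
    (t : ComplexPoints S)
    (γ : Path.Homotopic.Quotient (⟨s, Set.mem_univ s⟩ : (Set.univ : Set (ComplexPoints S)))
      ⟨t, Set.mem_univ t⟩) :
    transportFun f (2 * p) hU γ T ∈ motivatedClasses d (fiberOver f t) p := by
  haveI := hf.isSmoothProjective_base.smoothOfRelativeDimension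
  haveI := compactPencil_irreducibleSpace_base hf
  exact transportFun_mem_motivatedClasses_of_finiteIndex_smoothCurve hGIC h05 f hf.isSmoothProjectiveFamily
    (compactPencil_exists_closedImmersion hf)
    (IsQuasiProjectiveOver.of_isProjectiveOver hf.isSmoothProjective_base.isProjectiveOver) hU hT H hH t γ

/-- **`R²ᵖ f_* ℂ` of a compact pencil of abelian varieties is a local system on `S(ℂ)`** (Ehresmann
for the smooth projective family over the smooth projective base curve) — the witness `hU` consumed
by `transportFun_mem_motivatedClasses_of_finiteIndex_compactPencil`, so that the corollary is usable
on the bare pencil hypothesis. [cite: VoisinHodgeI2002, Thm. 9.3 and §9.2.1] -/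
theorem isCohomologicallyLocallyTrivialOn_univ_of_isCompactAbelianPencil
    {d : ℕ} {𝒳 S : SchemeOver ℂ} {f : 𝒳 ⟶ S} (hf : IsCompactAbelianPencil f d) :
    IsCohomologicallyLocallyTrivialOn f (Set.univ : Set (ComplexPoints S)) :=
  haveI := hf.isSmoothProjective_base.smoothOfRelativeDimension
  isCohomologicallyLocallyTrivialOn_univ_of_isSmoothProjectiveFamily f 1 hf.isSmoothProjectiveFamily
    (IsQuasiProjectiveOver.of_isProjectiveOver hf.isSmoothProjective_base.isProjectiveOver)

end Literature.AlgebraicGeometry.Andre1996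

end
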